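import Summits.NavierStokesRegularity.NavierStokesRegularity.Theses.LevelSetModeration
import Literature.Analysis.FluidPDE.TsaiMaximumPrinciple

/-!
# Route LevelSetModeration — `HighSpeedPressureWork`: a weak maximum principle for bounded
# subsolutions of the drift–heat operator on `ℝ³ × [0, t]`

Support file for item stmt-NavierStokesRegularity-18149 (towards the registered stub `stub_headCeiling`
of line `Sketch`: the comoving Bernoulli head is a subsolution of `∂ₜ + u·∇ − νΔ`). The analytic core,
with no Navier–Stokes content:

* `levelSetModeration_weakMaxPrinciple` — let `w` be jointly continuous on `[0,t] × ℝ³`, with `C²`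
  slices and one-sided time derivatives `wₜ` within `[0,T)` (`0 < t < T`), bounded above, with
  `wₜ + Dw(a) − νΔw ≤ 0` on `(0,t] × ℝ³` for a drift `a` bounded by `B` (`ν ≥ 0`), and `w(0,·) ≤ 0`.
  Then `w ≤ 0` on `[0,t] × ℝ³`.

Proof (Lieberman 1996, Ch. II, Lemma 2.1 / Evans §7.1.4 Thm. 8, with the standard whole-space
barrier): for the barrier `ψ(τ,x) = e^{λτ}(1 + |x|²)`, `λ = 2B + 6ν + 1`, one has
`ψₜ + Dψ(a) − νΔψ ≥ e^{λτ}(λ(1+|x|²) − 2B|x| − 6ν) > 0`; if `w > 0` somewhere, `v = w − εψ` (small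
`ε > 0`) is still positive there, negative at `τ = 0` and outside a large ball, so it attains a
positive maximum over the compact `[0,t] × B̄_R` at an interior point `(τ*, x*)`, `τ* > 0`,
`|x*| < R`; there `Dv = 0`, `Δv ≤ 0` (second-order condition, `laplacian_nonpos_of_isLocalMax`) and
`vₜ ≥ 0` (Fermat on the positive tangent cone of `[0, τ*]`), whence
`wₜ + Dw(a) − νΔw ≥ ε(ψₜ + Dψ(a) − νΔψ) > 0`, a contradiction.

## References
* G. M. Lieberman, *Second order parabolic differential equations* (1996), Ch. II, Lemma 2.1. [Lieberman1996]
* L. C. Evans, *Partial Differential Equations* (2010), §7.1.4, Thm. 8. [Evans2010]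
-/

noncomputable section

-- single-conjunct summit: `Summit.<Summit>.<Problem>` repeats the name by the D-0017 layout
set_option linter.dupNamespace false

namespace Summit.NavierStokesRegularity.NavierStokesRegularity.Theorems

open Set Filter Topology Function Metric
open scoped RealInnerProductSpace Laplacian
open Literature.Analysis.FluidPDE

/-- **The whole-space barrier** `b(x) = 1 + |x|²` on `ℝ³`: smooth, `Db(x)(a) = 2⟨x, a⟩`, `Δb = 6`.
[folklore] -/
theorem levelSetModeration_barrier_calculus (x a : EuclideanSpace ℝ (Fin 3)) :
    ContDiff ℝ 2 (fun y : EuclideanSpace ℝ (Fin 3) => (1 + ‖y‖ ^ 2 : ℝ)) ∧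
      fderiv ℝ (fun y : EuclideanSpace ℝ (Fin 3) => (1 + ‖y‖ ^ 2 : ℝ)) x a = 2 * ⟪x, a⟫ ∧
      (Δ (fun y : EuclideanSpace ℝ (Fin 3) => (1 + ‖y‖ ^ 2 : ℝ))) x = 6 := by
  have hg : ∀ σ ∈ (univ : Set ℝ), HasDerivAt (fun σ : ℝ => 1 + σ) 1 σ := fun σ _ =>
    (hasDerivAt_id' σ).const_add 1
  refine ⟨contDiff_const.add (contDiff_norm_sq ℝ), ?_, ?_⟩
  · have h := fderiv_comp_norm_sq_apply (E := EuclideanSpace ℝ (Fin 3)) (g := fun σ : ℝ => 1 + σ)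
      (hg _ (mem_univ _)) (z := x) a
    rw [h]; ring
  · have h := laplacian_comp_norm_sq (E := EuclideanSpace ℝ (Fin 3)) (g := fun σ : ℝ => 1 + σ)
      (g₁ := fun _ => (1 : ℝ)) (g₂ := 0) isOpen_univ hg (z := x) (mem_univ _)
      (hasDerivAt_const _ _)
    rw [h, finrank_euclideanSpace_fin]
    norm_num

/-- **Weak maximum principle for bounded subsolutions of `∂ₜ + a·∇ − νΔ` on `ℝ³ × [0,t]`.** Let
`t < T`, `ν ≥ 0`, `B ≥ 0`. Let `w : ℝ → ℝ³ → ℝ` be jointly continuous on `[0,t] × ℝ³`, with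
`C²` slices `w(τ,·)` and time derivatives `wₜ(τ,x)` within `[0,T)` for `τ ∈ (0,t]`, bounded above
by `C` on `[0,t] × ℝ³`, with `wₜ + Dw(a) − νΔw ≤ 0` on `(0,t] × ℝ³` for a drift `‖a‖ ≤ B`, and
`w(0,·) ≤ 0`. Then `w ≤ 0` on `[0,t] × ℝ³`. [cite: Lieberman1996, Ch. II Lemma 2.1] -/
theorem levelSetModeration_weakMaxPrinciple {w wt : ℝ → EuclideanSpace ℝ (Fin 3) → ℝ}
    {a : ℝ → EuclideanSpace ℝ (Fin 3) → EuclideanSpace ℝ (Fin 3)} {ν B C t T : ℝ}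
    (hν : 0 ≤ ν) (htT : t < T) (hB : 0 ≤ B)
    (hcont : ContinuousOn (uncurry w) (Icc 0 t ×ˢ univ))
    (hC2 : ∀ τ ∈ Ioc 0 t, ContDiff ℝ 2 (w τ))
    (htime : ∀ τ ∈ Ioc 0 t, ∀ x, HasDerivWithinAt (fun s => w s x) (wt τ x) (Ico 0 T) τ)
    (ha : ∀ τ ∈ Ioc 0 t, ∀ x, ‖a τ x‖ ≤ B)
    (hsub : ∀ τ ∈ Ioc 0 t, ∀ x, wt τ x + fderiv ℝ (w τ) x (a τ x) - ν * (Δ (w τ)) x ≤ 0)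
    (hbdd : ∀ τ ∈ Icc 0 t, ∀ x, w τ x ≤ C) (h0 : ∀ x, w 0 x ≤ 0) :
    ∀ τ ∈ Icc 0 t, ∀ x, w τ x ≤ 0 := by
  intro τ₁ hτ₁ x₁
  by_contra hpos
  rw [not_le] at hpos
  -- the barrier
  set lam : ℝ := 2 * B + 6 * ν + 1 with hlam
  have hlam0 : 0 < lam := by rw [hlam]; positivity
  set b : EuclideanSpace ℝ (Fin 3) → ℝ := fun y => (1 + ‖y‖ ^ 2 : ℝ) with hb
  set ψ : ℝ → EuclideanSpace ℝ (Fin 3) → ℝ := fun τ y => Real.exp (lam * τ) * b y with hψ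
  have hb1 : ∀ y, 1 ≤ b y := fun y => by
    show 1 ≤ 1 + ‖y‖ ^ 2; nlinarith [norm_nonneg y]
  have hψpos : ∀ τ y, 0 < ψ τ y := fun τ y => mul_pos (Real.exp_pos _) (by linarith [hb1 y])
  have hψ_ge : ∀ τ y, 0 ≤ τ → b y ≤ ψ τ y := fun τ y hτ => by
    show b y ≤ Real.exp (lam * τ) * b y
    have h1 : 1 ≤ Real.exp (lam * τ) := Real.one_le_exp (by positivity)
    nlinarith [hb1 y]
  -- the perturbation `v = w - ε ψ`, `ε` so small that `v(τ₁, x₁) > 0`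
  set δ : ℝ := w τ₁ x₁ with hδ
  set ε : ℝ := δ / (2 * ψ τ₁ x₁) with hε
  have hεpos : 0 < ε := div_pos hpos (by linarith [hψpos τ₁ x₁])
  set v : ℝ → EuclideanSpace ℝ (Fin 3) → ℝ := fun τ y => w τ y - ε * ψ τ y with hv
  have hv1 : 0 < v τ₁ x₁ := by
    show 0 < w τ₁ x₁ - ε * ψ τ₁ x₁
    have hψne : ψ τ₁ x₁ ≠ 0 := (hψpos τ₁ x₁).ne'
    have : ε * ψ τ₁ x₁ = δ / 2 := by
      rw [hε]; field_simp
    rw [this, ← hδ]; linarith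
  -- a large ball outside which `v < 0`
  set R : ℝ := max (‖x₁‖ + 1) (Real.sqrt (|C| / ε) + 1) with hR
  have hx₁R : ‖x₁‖ < R := lt_of_lt_of_le (by linarith) (le_max_left _ _)
  have hvneg : ∀ τ ∈ Icc 0 t, ∀ y, R ≤ ‖y‖ → v τ y < 0 := by
    intro τ hτ y hy
    have h1 : Real.sqrt (|C| / ε) + 1 ≤ ‖y‖ := (le_max_right _ _).trans hy
    have h2 : Real.sqrt (|C| / ε) < ‖y‖ := by linarith
    have h3 : |C| / ε < ‖y‖ ^ 2 := by
      have hs := Real.sqrt_nonneg (|C| / ε)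
      have := Real.sq_sqrt (show 0 ≤ |C| / ε by positivity)
      nlinarith
    have h4 : |C| < ε * ‖y‖ ^ 2 := by rwa [div_lt_iff₀' hεpos] at h3
    have h5 : C < ε * b y := by
      show C < ε * (1 + ‖y‖ ^ 2)
      nlinarith [le_abs_self C, hεpos]
    show w τ y - ε * ψ τ y < 0
    have h6 := hbdd τ hτ y
    have h7 : ε * b y ≤ ε * ψ τ y := mul_le_mul_of_nonneg_left (hψ_ge τ y hτ.1) hεpos.le
    linarith
  -- the compact `K = [0,t] × B̄_R` and a maximiser of `v` on it
  set K : Set (ℝ × EuclideanSpace ℝ (Fin 3)) := Icc 0 t ×ˢ closedBall 0 R with hK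
  have hKc : IsCompact K := isCompact_Icc.prod (isCompact_closedBall _ _)
  have hKne : K.Nonempty := ⟨(τ₁, x₁), ⟨hτ₁, mem_closedBall_zero_iff.2 hx₁R.le⟩⟩
  have hψc : Continuous (uncurry ψ) := by
    show Continuous fun z : ℝ × EuclideanSpace ℝ (Fin 3) => Real.exp (lam * z.1) * (1 + ‖z.2‖ ^ 2)
    fun_prop
  have hvc : ContinuousOn (uncurry v) K := by
    have h1 : ContinuousOn (uncurry w) K := hcont.mono (prod_mono Subset.rfl (subset_univ _))
    have h2 : ContinuousOn (fun z : ℝ × EuclideanSpace ℝ (Fin 3) => ε * uncurry ψ z) K :=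
      (continuous_const.mul hψc).continuousOn
    exact h1.sub h2
  obtain ⟨⟨τs, xs⟩, hzK, hzmax⟩ := hKc.exists_isMaxOn hKne hvc
  have hτs : τs ∈ Icc 0 t := (mem_prod.1 hzK).1
  have hxs : xs ∈ closedBall (0 : EuclideanSpace ℝ (Fin 3)) R := (mem_prod.1 hzK).2
  have hmax : ∀ τ ∈ Icc 0 t, ∀ y ∈ closedBall (0 : EuclideanSpace ℝ (Fin 3)) R, v τ y ≤ v τs xs := by
    intro τ hτ y hy
    have h := (isMaxOn_iff.1 hzmax) (τ, y) (mem_prod.2 ⟨hτ, hy⟩)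
    exact h
  have hvpos : 0 < v τs xs :=
    hv1.trans_le (hmax τ₁ hτ₁ x₁ (mem_closedBall_zero_iff.2 hx₁R.le))
  -- `τs > 0`: at `τ = 0`, `v < 0`
  have hτs0 : 0 < τs := by
    rcases eq_or_lt_of_le hτs.1 with h | h
    · exfalso
      have : v 0 xs < 0 := by
        show w 0 xs - ε * ψ 0 xs < 0
        have := h0 xs
        have := mul_pos hεpos (hψpos 0 xs)
        linarith
      rw [← h] at hvpos
      exact absurd hvpos (not_lt.2 this.le)
    · exact h
  have hτs' : τs ∈ Ioc 0 t := ⟨hτs0, hτs.2⟩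
  -- `‖xs‖ < R`: outside the ball `v < 0`
  have hxsR : ‖xs‖ < R := by
    by_contra hge
    exact absurd hvpos (not_lt.2 (hvneg τs hτs xs (not_lt.1 hge)).le)
  -- spatial conditions at the interior maximum
  obtain ⟨hbC2, hDb, hΔb⟩ := levelSetModeration_barrier_calculus xs (a τs xs)
  have hψC2 : ContDiff ℝ 2 (ψ τs) := by
    show ContDiff ℝ 2 fun y => Real.exp (lam * τs) * b y
    exact contDiff_const.mul hbC2
  have hvC2 : ContDiff ℝ 2 (v τs) := by
    show ContDiff ℝ 2 fun y => w τs y - ε * ψ τs y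
    exact (hC2 τs hτs').sub (contDiff_const.mul hψC2)
  have hloc : IsLocalMax (v τs) xs := by
    have hball : ball (0 : EuclideanSpace ℝ (Fin 3)) R ∈ 𝓝 xs :=
      isOpen_ball.mem_nhds (mem_ball_zero_iff.2 hxsR)
    filter_upwards [hball] with y hy
    exact hmax τs hτs y (ball_subset_closedBall hy)
  have hD0 : fderiv ℝ (v τs) xs = 0 := hloc.fderiv_eq_zero
  have hΔv : (Δ (v τs)) xs ≤ 0 := laplacian_nonpos_of_isLocalMax hvC2 hloc
  -- read off `Dw` and `Δw` at `(τs, xs)`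
  have hwd : DifferentiableAt ℝ (w τs) xs := ((hC2 τs hτs').differentiable two_ne_zero) xs
  have hψd : DifferentiableAt ℝ (ψ τs) xs := (hψC2.differentiable two_ne_zero) xs
  have hDψ : fderiv ℝ (ψ τs) xs (a τs xs) = Real.exp (lam * τs) * (2 * ⟪xs, a τs xs⟫) := by
    show fderiv ℝ (fun y => Real.exp (lam * τs) * b y) xs (a τs xs) = _
    rw [fderiv_const_mul ((hbC2.differentiable two_ne_zero) xs)]
    rw [smul_apply, smul_eq_mul, hDb]
  have hDw : fderiv ℝ (w τs) xs (a τs xs) = ε * (Real.exp (lam * τs) * (2 * ⟪xs, a τs xs⟫)) := by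
    have h1 : fderiv ℝ (v τs) xs = fderiv ℝ (w τs) xs - ε • fderiv ℝ (ψ τs) xs := by
      show fderiv ℝ (fun y => w τs y - ε * ψ τs y) xs = _
      rw [fderiv_fun_sub hwd (hψd.const_mul ε), fderiv_const_mul hψd]
    have h2 := congrArg (fun L : EuclideanSpace ℝ (Fin 3) →L[ℝ] ℝ => L (a τs xs)) h1
    simp only [hD0, zero_apply, sub_apply, smul_apply, smul_eq_mul, hDψ] at h2
    linarith
  have hΔψ : (Δ (ψ τs)) xs = Real.exp (lam * τs) * 6 := by
    show (Δ (fun y => Real.exp (lam * τs) * b y)) xs = _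
    have : (fun y => Real.exp (lam * τs) * b y) = Real.exp (lam * τs) • b := by
      funext y; simp [smul_eq_mul]
    rw [this, InnerProductSpace.laplacian_smul _ hbC2.contDiffAt, smul_eq_mul, hΔb]
  have hΔw : (Δ (w τs)) xs ≤ ε * (Real.exp (lam * τs) * 6) := by
    have h1 : (Δ (v τs)) xs = (Δ (w τs)) xs + (-ε) * (Δ (ψ τs)) xs := by
      have hfun : v τs = w τs + (-ε) • ψ τs := by
        funext y; show w τs y - ε * ψ τs y = w τs y + (-ε) * ψ τs y; ring
      have hsm : ContDiff ℝ 2 ((-ε) • ψ τs) := hψC2.const_smul (-ε)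
      rw [hfun, ContDiffAt.laplacian_add (hC2 τs hτs').contDiffAt hsm.contDiffAt,
        InnerProductSpace.laplacian_smul _ hψC2.contDiffAt, smul_eq_mul]
    rw [hΔψ] at h1
    linarith
  -- temporal condition at the maximum: the one-sided derivative is `≥ 0`
  have hbt : HasDerivAt (fun s => ε * ψ s xs) (ε * (lam * Real.exp (lam * τs) * b xs)) τs := by
    show HasDerivAt (fun s => ε * (Real.exp (lam * s) * b xs)) _ τs
    have h1 : HasDerivAt (fun s => Real.exp (lam * s)) (Real.exp (lam * τs) * (lam * 1)) τs :=
      ((hasDerivAt_id' τs).const_mul lam).exp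
    have h2 := (h1.mul_const (b xs)).const_mul ε
    exact h2.congr_deriv (by ring)
  have hft : HasDerivWithinAt (fun s => v s xs) (wt τs xs - ε * (lam * Real.exp (lam * τs) * b xs))
      (Ico 0 T) τs := by
    show HasDerivWithinAt (fun s => w s xs - ε * ψ s xs) _ (Ico 0 T) τs
    exact (htime τs hτs' xs).sub hbt.hasDerivWithinAt
  have hvt : 0 ≤ wt τs xs - ε * (lam * Real.exp (lam * τs) * b xs) := by
    -- Fermat on the positive tangent cone of `[0, τs]` at `τs`, direction `-τs`
    have hsub' : Icc 0 τs ⊆ Ico 0 T := fun s hs => ⟨hs.1, hs.2.trans_lt (hτs.2.trans_lt htT)⟩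
    have hft' := (hft.mono hsub').hasFDerivWithinAt
    have hmaxOn : IsLocalMaxOn (fun s => v s xs) (Icc 0 τs) τs :=
      IsMaxOn.localize fun s hs => hmax s ⟨hs.1, hs.2.trans hτs.2⟩ xs hxs
    have hy : (0 : ℝ) - τs ∈ posTangentConeAt (Icc 0 τs) τs := by
      refine sub_mem_posTangentConeAt_of_segment_subset ?_
      rw [segment_symm, segment_eq_Icc hτs0.le]
    have h := hmaxOn.hasFDerivWithinAt_nonpos hft' hy
    simp only [ContinuousLinearMap.toSpanSingleton_apply, smul_eq_mul, zero_sub] at h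
    nlinarith
  -- the contradiction: `L w ≥ ε L ψ > 0` at `(τs, xs)`
  have hkey := hsub τs hτs' xs
  have hr : 2 * ⟪xs, a τs xs⟫ ≥ -(2 * ‖xs‖ * B) := by
    have h1 : |⟪xs, a τs xs⟫| ≤ ‖xs‖ * ‖a τs xs‖ := abs_real_inner_le_norm _ _
    have h2 : ‖xs‖ * ‖a τs xs‖ ≤ ‖xs‖ * B := mul_le_mul_of_nonneg_left (ha τs hτs' xs) (norm_nonneg _)
    have h3 := neg_abs_le ⟪xs, a τs xs⟫
    linarith
  have hexp : 0 < Real.exp (lam * τs) := Real.exp_pos _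
  have hbpos : 0 < b xs := by linarith [hb1 xs]
  -- `L ψ ≥ e^{λτ}(λ b − 2B‖xs‖ − 6ν) ≥ e^{λτ} > 0`
  have hbar : lam * b xs - 2 * ‖xs‖ * B - 6 * ν ≥ 1 := by
    show (2 * B + 6 * ν + 1) * (1 + ‖xs‖ ^ 2) - 2 * ‖xs‖ * B - 6 * ν ≥ 1
    nlinarith [norm_nonneg xs, sq_nonneg (‖xs‖ - 1), hB, hν]
  have hpos' : 0 < ε * Real.exp (lam * τs) * (lam * b xs - 2 * ‖xs‖ * B - 6 * ν) := by
    have := mul_pos (mul_pos hεpos hexp) (show (0 : ℝ) < lam * b xs - 2 * ‖xs‖ * B - 6 * ν by linarith)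
    linarith
  -- assemble the lower bound for `L w`
  have hL : wt τs xs + fderiv ℝ (w τs) xs (a τs xs) - ν * (Δ (w τs)) xs ≥
      ε * Real.exp (lam * τs) * (lam * b xs - 2 * ‖xs‖ * B - 6 * ν) := by
    rw [hDw]
    have h1 : -(ν * (Δ (w τs)) xs) ≥ -(ν * (ε * (Real.exp (lam * τs) * 6))) := by
      have := mul_le_mul_of_nonneg_left hΔw hν
      linarith
    have h2 : ε * (Real.exp (lam * τs) * (2 * ⟪xs, a τs xs⟫)) ≥
        ε * (Real.exp (lam * τs) * (-(2 * ‖xs‖ * B))) := by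
      have := mul_le_mul_of_nonneg_left hr hexp.le
      exact mul_le_mul_of_nonneg_left (by linarith) hεpos.le
    nlinarith [hvt, h1, h2]
  linarith

/-- **Weak maximum principle** (explicit form of `levelSetModeration_weakMaxPrinciple`, registered
sub-goal of the crux item). [cite: Lieberman1996, Ch. II Lemma 2.1] -/
theorem levelSetModeration_weakMaximumPrinciple :
    ∀ (w wt : ℝ → EuclideanSpace ℝ (Fin 3) → ℝ) (a : ℝ → EuclideanSpace ℝ (Fin 3) → EuclideanSpace ℝ (Fin 3)) (ν B C t T : ℝ), 0 ≤ ν → t < T → 0 ≤ B → ContinuousOn (Function.uncurry w) (Set.Icc 0 t ×ˢ Set.univ) → (∀ τ ∈ Set.Ioc 0 t, ContDiff ℝ 2 (w τ)) → (∀ τ ∈ Set.Ioc 0 t, ∀ x, HasDerivWithinAt (fun s => w s x) (wt τ x) (Set.Ico 0 T) τ) → (∀ τ ∈ Set.Ioc 0 t, ∀ x, ‖a τ x‖ ≤ B) → (∀ τ ∈ Set.Ioc 0 t, ∀ x, wt τ x + fderiv ℝ (w τ) x (a τ x) - ν * Laplacian.laplacian (w τ) x ≤ 0) → (∀ τ ∈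 Set.Icc 0 t, ∀ x, w τ x ≤ C) → (∀ x, w 0 x ≤ 0) → ∀ τ ∈ Set.Icc 0 t, ∀ x, w τ x ≤ 0 :=
  fun _ _ _ _ _ _ _ _ hν htT hB hcont hC2 htime ha hsub hbdd h0 =>
    levelSetModeration_weakMaxPrinciple hν htT hB hcont hC2 htime ha hsub hbdd h0

end Summit.NavierStokesRegularity.NavierStokesRegularity.Theorems
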